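import Summits.Ventures.Crystal3D.Theorems.StickyWulffConstantTextureLiminfTexShadowColumnWord
import Summits.Ventures.Crystal3D.Theorems.StickyWulffConstantGenericWallFloorDozenStep
import HarnessLib

/-!
# The column word lemma, IV: LABEL PROPAGATION along a column of close-packed-saturated balls (input (I5) of the terrace census,
# configuration side; cf-p1 RULINGS (ccxxxv)(iii), (ccxli); lane T `TexShadow`, registered stub `stub_terraceCensus`, crux `TextureLiminfV5`)

HONEST FRAMING. Venture `Summits/Ventures/Crystal3D` (cell `crystal3d-full`), route `route-Ventures-StickyWulffConstant`, helper
`--supports` the law-v5 crux `TextureLiminfV5` (stmt-Ventures-23912), lane T, mechanism (β); owner of input (I5) `stub_columnWord`: 19480-p2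
g15.  Census-free geometry of finite `1`-separated configurations; standard axioms; clean import closure (RULING (ccxxxix) probe: …ColumnWord,
…GenericWallFloorDozenStep).  Nothing about energies; F-C1 not moved.

THE POINT.  `ColumnWord.column_theorem` (…TexShadowColumnWord) consumes a CHAIN of affine twin steps; this file produces that chain from the
GEOMETRY of a column: a ball `y` ANCHORED in an affine lattice `(A· + t)''Λ₀` (it lies on it and owns three linearly independent exact slot
neighbours `y + A a, y + A b, y + A c ∈ X`) whose contact dozen is close-packed (`IsClosePackedDozenAt`) is, by the single-dozen algebra of
…SlotDozens, EITHER `A`-FULL (all twelve slots occupied; its contacts are exactly `y + A·fccSlots`) OR a MIRROR BALL: for a unit menu normal `n` of `A`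
the nine slots with `⟪A w, n⟫ ≤ 0` are occupied, the three mirror sites `y + A w − 2⟪A w, n⟫ n` (`⟪A w, n⟫ < 0`) are occupied, and these twelve are
ALL its contacts (`fullShell_or_twinDozen_of_isClosePackedDozenAt`, the `IsClosePackedDozenAt` form of …DozenStep's dichotomy).  Hence the NEXT ball
`z` of the column (a contact of `y`) is anchored again — in the same affine lattice (`anchored_of_fullShell`, `anchored_of_own_polar`,
`anchored_of_inPlane`), or, when `z` is a mirror site, in the AFFINE TWIN across the plane through `y` (`anchored_of_crossing`: frame
`twinFrame A n`, origin `t + 2⟪y − t, n⟫ n`, exactly one step of `column_theorem`'s chain with located mirror ball `b = y`).  The in-plane case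
uses a kernel-decided table of slot triples (`inPlane_table`).
WHAT THIS IS NOT: the (I5) Def wording and the packaged induction over a whole column (mechanical from the four step lemmas; left to the
assembly file so that its binders match …LevelLedgerDefs); F-C1 not moved.
-/

noncomputable section

open scoped BigOperators

namespace Summit.Ventures.Crystal3D.Theorems

namespace ColumnWord

open Finset Matrix Summit.Ventures.Crystal3D ReflWord NearIdentity
open Summit.Ventures.Crystal3D.Cruxes.TextureLiminf.TexShadow (E3 fccRef add_mem_fccRef)
open Literature.MathematicalPhysics.StatisticalMechanics (fccStacking)
open Literature.Geometry.DiscreteGeometry (fccKissingPattern hcpKissingPattern)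
open scoped InnerProductSpace

variable {X : Finset (EuclideanSpace ℝ (Fin 3))}

/-! ### The dichotomy of a close-packed dozen over three independent exact slots, with the contact classification -/

/-- **Full shell or twin dozen** (`IsClosePackedDozenAt` form of …DozenStep's `fullShell_or_twinDozen_of_allButOne`), together with the
CLASSIFICATION of the contacts: if the contact dozen of `y` is close-packed and contains three linearly independent exact slots of the frame
`A`, then EITHER all twelve slots `y + A w` are occupied and every contact of `y` is one of them, OR for a unit menu normal `n` of `A` the nine
slots with `⟪A w, n⟫ ≤ 0` and the three mirror sites of the slots with `⟪A w, n⟫ < 0` are occupied, the three slots with `⟪A w, n⟫ > 0` are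
empty, every contact of `y` is one of those twelve, and `a, b, c` lie on the own side. -/
theorem fullShell_or_twinDozen_of_isClosePackedDozenAt {y : EuclideanSpace ℝ (Fin 3)}
    (hcp : IsClosePackedDozenAt y (X.filter fun q => dist y q = 1))
    (A : EuclideanSpace ℝ (Fin 3) ≃ₗᵢ[ℝ] EuclideanSpace ℝ (Fin 3)) {a b c : EuclideanSpace ℝ (Fin 3)}
    (ha : a ∈ fccSlots) (hb : b ∈ fccSlots) (hc' : c ∈ fccSlots) (hind : LinearIndependent ℝ ![a, b, c])
    (haX : y + A a ∈ X) (hbX : y + A b ∈ X) (hcX : y + A c ∈ X) :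
    ((∀ w ∈ fccSlots, y + A w ∈ X) ∧ ∀ z ∈ X, dist y z = 1 → ∃ w ∈ fccSlots, z = y + A w) ∨
    ∃ n : EuclideanSpace ℝ (Fin 3), ‖n‖ = 1 ∧
      (∀ w ∈ fccSlots, ⟪A w, n⟫_ℝ = 0 ∨ ⟪A w, n⟫_ℝ = Real.sqrt (2 / 3) ∨ ⟪A w, n⟫_ℝ = -Real.sqrt (2 / 3)) ∧
      (∀ w ∈ fccSlots, ⟪A w, n⟫_ℝ ≤ 0 → y + A w ∈ X) ∧
      (∀ w ∈ fccSlots, ⟪A w, n⟫_ℝ < 0 → y + (A w - (2 * ⟪A w, n⟫_ℝ) • n) ∈ X) ∧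
      (∀ w ∈ fccSlots, 0 < ⟪A w, n⟫_ℝ → y + A w ∉ X) ∧
      (∀ z ∈ X, dist y z = 1 →
        (∃ w ∈ fccSlots, ⟪A w, n⟫_ℝ ≤ 0 ∧ z = y + A w) ∨
        (∃ w ∈ fccSlots, ⟪A w, n⟫_ℝ < 0 ∧ z = y + (A w - (2 * ⟪A w, n⟫_ℝ) • n))) ∧
      ⟪A a, n⟫_ℝ ≤ 0 ∧ ⟪A b, n⟫_ℝ ≤ 0 ∧ ⟪A c, n⟫_ℝ ≤ 0 := by
  classical
  obtain ⟨B, hB⟩ := hcp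
  -- the pattern `P` with `↑D = (B· + y) '' P`
  have hP : ∃ P : Finset (EuclideanSpace ℝ (Fin 3)), (P = fccKissingPattern ∨ P = hcpKissingPattern) ∧
      (↑(X.filter fun q => dist y q = 1) : Set (EuclideanSpace ℝ (Fin 3))) = (fun p => B p + y) '' ↑P := by
    rcases hB with h | h
    · exact ⟨fccKissingPattern, Or.inl rfl, h⟩
    · exact ⟨hcpKissingPattern, Or.inr rfl, h⟩
  obtain ⟨P, hPP, hD⟩ := hP
  -- exact slots are pattern vectors, pattern vectors are contacts
  have key : ∀ w ∈ fccSlots, y + A w ∈ X → A w ∈ B '' (↑P : Set (EuclideanSpace ℝ (Fin 3))) := by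
    intro w hw hwX
    have hmem : y + A w ∈ (↑(X.filter fun q => dist y q = 1) : Set (EuclideanSpace ℝ (Fin 3))) := by
      rw [Finset.mem_coe, Finset.mem_filter]
      exact ⟨hwX, by rw [dist_self_add_right, LinearIsometryEquiv.norm_map, norm_eq_one_of_mem_fccSlots hw]⟩
    rw [hD] at hmem
    obtain ⟨p, hp, he⟩ := hmem
    refine ⟨p, hp, ?_⟩
    have he' : B p + y = y + A w := he
    exact add_right_cancel (he'.trans (add_comm _ _))
  have back : ∀ v ∈ B '' (↑P : Set (EuclideanSpace ℝ (Fin 3))), y + v ∈ X := by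
    rintro v ⟨p, hp, rfl⟩
    have hmem : B p + y ∈ (↑(X.filter fun q => dist y q = 1) : Set (EuclideanSpace ℝ (Fin 3))) := by
      rw [hD]; exact ⟨p, hp, rfl⟩
    rw [Finset.mem_coe, Finset.mem_filter] at hmem
    rw [add_comm]; exact hmem.1
  have contacts : ∀ z ∈ X, dist y z = 1 → z - y ∈ B '' (↑P : Set (EuclideanSpace ℝ (Fin 3))) := by
    intro z hz hd
    have hmem : z ∈ (↑(X.filter fun q => dist y q = 1) : Set (EuclideanSpace ℝ (Fin 3))) := by
      rw [Finset.mem_coe, Finset.mem_filter]; exact ⟨hz, hd⟩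
    rw [hD] at hmem
    obtain ⟨p, hp, he⟩ := hmem
    exact ⟨p, hp, by rw [← he, add_sub_cancel_right]⟩
  have slotA : ∀ w ∈ fccSlots, A w ∈ A '' (↑fccSlots : Set (EuclideanSpace ℝ (Fin 3))) :=
    fun w hw => ⟨w, Finset.mem_coe.2 hw, rfl⟩
  have hind' : LinearIndependent ℝ ![A a, A b, A c] := linearIndependent_map_triple A hind
  rcases hPP with rfl | rfl
  · left
    have hEq := fccDozen_eq_slots_of_three_independent A B (key a ha haX) (key b hb hbX) (key c hc' hcX)
      (slotA a ha) (slotA b hb) (slotA c hc') hind'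
    refine ⟨fun w hw => back _ (by rw [hEq]; exact slotA w hw), fun z hz hd => ?_⟩
    have h1 := contacts z hz hd
    rw [hEq] at h1
    obtain ⟨w, hw, he⟩ := h1
    exact ⟨w, Finset.mem_coe.1 hw, by rw [he, add_sub_cancel]⟩
  · right
    obtain ⟨n, hn, hmenu, hDn⟩ := hcpDozen_twin_of_three_independent A B (key a ha haX) (key b hb hbX)
      (key c hc' hcX) (slotA a ha) (slotA b hb) (slotA c hc') hind'
    refine ⟨n, hn, hmenu, ?_, ?_, ?_, ?_, (slot_mem_twinDozen_iff A hn hmenu hDn ha).1 (key a ha haX),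
      (slot_mem_twinDozen_iff A hn hmenu hDn hb).1 (key b hb hbX),
      (slot_mem_twinDozen_iff A hn hmenu hDn hc').1 (key c hc' hcX)⟩
    · intro w hw hle
      apply back; rw [hDn]; exact Or.inl ⟨w, ⟨hw, hle⟩, rfl⟩
    · intro w hw hlt
      apply back; rw [hDn]; exact Or.inr ⟨w, ⟨hw, hlt⟩, rfl⟩
    · intro w hw hpos hwX
      have := (slot_mem_twinDozen_iff A hn hmenu hDn hw).1 (key w hw hwX)
      linarith
    · intro z hz hd
      have h1 := contacts z hz hd
      rw [hDn] at h1
      rcases h1 with ⟨w, ⟨hw, hle⟩, he⟩ | ⟨w, ⟨hw, hlt⟩, he⟩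
      · exact Or.inl ⟨w, hw, hle, by rw [← sub_eq_iff_eq_add'.1 he.symm]⟩
      · exact Or.inr ⟨w, hw, hlt, by rw [← sub_eq_iff_eq_add'.1 he.symm]⟩

/-! ### Anchoring of the next ball: the full shell -/

/-- **After an `A`-full ball the next ball is anchored in the SAME affine lattice**: if `y ∈ (A· + t)''Λ₀` has all twelve slots occupied, its
contact `z = y + A w₀` lies in `(A· + t)''Λ₀` and owns three linearly independent exact `A`-slot neighbours. -/
theorem anchored_of_fullShell (A : EuclideanSpace ℝ (Fin 3) ≃ₗᵢ[ℝ] EuclideanSpace ℝ (Fin 3)) {t y : EuclideanSpace ℝ (Fin 3)}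
    (hyL : y ∈ (fun r => A r + t) '' fccRef) (hy : y ∈ X) (hfull : ∀ w ∈ fccSlots, y + A w ∈ X)
    {w₀ : EuclideanSpace ℝ (Fin 3)} (hw₀ : w₀ ∈ fccSlots) :
    y + A w₀ ∈ (fun r => A r + t) '' fccRef ∧
      ∃ a ∈ fccSlots, ∃ b ∈ fccSlots, ∃ c ∈ fccSlots, LinearIndependent ℝ ![a, b, c] ∧
        y + A w₀ + A a ∈ X ∧ y + A w₀ + A b ∈ X ∧ y + A w₀ + A c ∈ X := by
  refine ⟨?_, exists_exact_neighbours_fcc_step A hy hfull hw₀⟩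
  rw [mem_affLat_iff_sub_mem hyL, add_sub_cancel_left]
  exact ⟨w₀, mem_fcc_of_mem_fccSlots hw₀, rfl⟩

/-! ### Anchoring of the next ball: crossing the twin plane -/

/-- **Crossing a mirror ball: the next ball is anchored in the AFFINE TWIN.**  In the twin-dozen alternative at `y ∈ (A· + t)''Λ₀` (unit menu normal `n`),
the mirror site `z = y + A w₀ − 2⟪A w₀, n⟫ n` (`⟪A w₀, n⟫ < 0`) equals `y + twinFrame A n w₀`, lies in the affine lattice of the twin frame with origin
`t + 2⟪y − t, n⟫ n` (one step of `column_theorem`'s chain with located mirror ball `b = y`), and owns three linearly independent exact slot neighbours in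
the twin frame. -/
theorem anchored_of_crossing (A : EuclideanSpace ℝ (Fin 3) ≃ₗᵢ[ℝ] EuclideanSpace ℝ (Fin 3)) {t y n : EuclideanSpace ℝ (Fin 3)}
    (hyL : y ∈ (fun r => A r + t) '' fccRef) (hy : y ∈ X) (hn : ‖n‖ = 1)
    (hmenu : ∀ w ∈ fccSlots, ⟪A w, n⟫_ℝ = 0 ∨ ⟪A w, n⟫_ℝ = Real.sqrt (2 / 3) ∨ ⟪A w, n⟫_ℝ = -Real.sqrt (2 / 3))
    (hown : ∀ w ∈ fccSlots, ⟪A w, n⟫_ℝ ≤ 0 → y + A w ∈ X)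
    (hmirror : ∀ w ∈ fccSlots, ⟪A w, n⟫_ℝ < 0 → y + (A w - (2 * ⟪A w, n⟫_ℝ) • n) ∈ X)
    {w₀ : EuclideanSpace ℝ (Fin 3)} (hw₀ : w₀ ∈ fccSlots) (hw₀n : ⟪A w₀, n⟫_ℝ < 0) :
    y + (A w₀ - (2 * ⟪A w₀, n⟫_ℝ) • n) = y + twinFrame A n w₀ ∧
      y + twinFrame A n w₀ ∈ (fun r => twinFrame A n r + (t + (2 * ⟪y - t, n⟫_ℝ) • n)) '' fccRef ∧
      ∃ a ∈ fccSlots, ∃ b ∈ fccSlots, ∃ c ∈ fccSlots, LinearIndependent ℝ ![a, b, c] ∧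
        y + twinFrame A n w₀ + twinFrame A n a ∈ X ∧ y + twinFrame A n w₀ + twinFrame A n b ∈ X ∧
        y + twinFrame A n w₀ + twinFrame A n c ∈ X := by
  have hA' : ∀ x, twinFrame A n x = A x - (2 * ⟪A x, n⟫_ℝ) • n := fun x => twinFrame_apply A hn x
  refine ⟨by rw [hA'], ?_, ?_⟩
  · -- `z` is the mirror image of the lattice point `y + A w₀` across the plane through `y`
    have hmem : y + A w₀ ∈ (fun r => A r + t) '' fccRef := by
      rw [mem_affLat_iff_sub_mem hyL, add_sub_cancel_left]
      exact ⟨w₀, mem_fcc_of_mem_fccSlots hw₀, rfl⟩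
    have himg : (y + A w₀) - (2 * ⟪(y + A w₀) - y, n⟫_ℝ) • n ∈
        (fun x => x - (2 * ⟪x - y, n⟫_ℝ) • n) '' ((fun r => A r + t) '' fccRef) := ⟨_, hmem, rfl⟩
    rw [image_reflect_affLat A hn t y] at himg
    have e : (y + A w₀) - (2 * ⟪(y + A w₀) - y, n⟫_ℝ) • n = y + twinFrame A n w₀ := by
      rw [add_sub_cancel_left, hA', add_sub_assoc]
    rwa [e] at himg
  · obtain ⟨a, ha, b, hb, c, hc, hind, haX, hbX, hcX⟩ :=
      exists_exact_neighbours_twin_step A (twinFrame A n) hy hn hmenu hown hmirror hA' hw₀ hw₀n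
    exact ⟨a, ha, b, hb, c, hc, hind, haX, hbX, hcX⟩

/-! ### Anchoring of the next ball: the own polar side -/

/-- **Stepping from a mirror ball to its own polar side keeps the affine lattice**: in the twin-dozen alternative at `y ∈ (A· + t)''Λ₀`, the contact
`z = y + A w₀` with `⟪A w₀, n⟫ < 0` lies in `(A· + t)''Λ₀` and owns three linearly independent exact `A`-slot neighbours (its back hemisphere: `y`
and the slots adjacent to `w₀`, all on the own side). -/
theorem anchored_of_own_polar (A : EuclideanSpace ℝ (Fin 3) ≃ₗᵢ[ℝ] EuclideanSpace ℝ (Fin 3)) {t y n : EuclideanSpace ℝ (Fin 3)}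
    (hyL : y ∈ (fun r => A r + t) '' fccRef) (hy : y ∈ X)
    (hmenu : ∀ w ∈ fccSlots, ⟪A w, n⟫_ℝ = 0 ∨ ⟪A w, n⟫_ℝ = Real.sqrt (2 / 3) ∨ ⟪A w, n⟫_ℝ = -Real.sqrt (2 / 3))
    (hown : ∀ w ∈ fccSlots, ⟪A w, n⟫_ℝ ≤ 0 → y + A w ∈ X)
    {w₀ : EuclideanSpace ℝ (Fin 3)} (hw₀ : w₀ ∈ fccSlots) (hw₀n : ⟪A w₀, n⟫_ℝ < 0) :
    y + A w₀ ∈ (fun r => A r + t) '' fccRef ∧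
      ∃ a ∈ fccSlots, ∃ b ∈ fccSlots, ∃ c ∈ fccSlots, LinearIndependent ℝ ![a, b, c] ∧
        y + A w₀ + A a ∈ X ∧ y + A w₀ + A b ∈ X ∧ y + A w₀ + A c ∈ X := by
  have hr0 : 0 ≤ Real.sqrt (2 / 3) := Real.sqrt_nonneg _
  refine ⟨?_, ?_⟩
  · rw [mem_affLat_iff_sub_mem hyL, add_sub_cancel_left]
    exact ⟨w₀, mem_fcc_of_mem_fccSlots hw₀, rfl⟩
  have hAw : A w₀ ≠ 0 := by
    rw [← norm_ne_zero_iff, LinearIsometryEquiv.norm_map, norm_eq_one_of_mem_fccSlots hw₀]; norm_num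
  obtain ⟨a, ha, b, hb, c, hc, ha', hb', hc', hind⟩ := exists_independent_slots_of_hemisphere A hAw
  -- `w₀` is a near-polar slot: `⟪A w₀, n⟫ = −√(2/3)`
  have hw₀v : ⟪A w₀, n⟫_ℝ = -Real.sqrt (2 / 3) := by
    rcases hmenu w₀ hw₀ with h | h | h
    · linarith
    · linarith
    · exact h
  have occ : ∀ w ∈ fccSlots, ⟪A w, A w₀⟫_ℝ < 0 → y + A w₀ + A w ∈ X := by
    intro w hw hneg
    rw [LinearIsometryEquiv.inner_map_map] at hneg
    rcases eq_neg_or_add_mem_fccSlots_of_inner_neg hw₀ hw hneg with rfl | hs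
    · rw [map_neg, add_neg_cancel_right]; exact hy
    · rw [add_assoc, ← map_add]
      apply hown _ hs
      -- `⟪A (w₀ + w), n⟫ ∈ {0, ±√(2/3)}` and `= −√(2/3) + ⟪A w, n⟫` with `⟪A w, n⟫ ∈ {0, ±√(2/3)}`
      have hsum : ⟪A (w₀ + w), n⟫_ℝ = -Real.sqrt (2 / 3) + ⟪A w, n⟫_ℝ := by rw [map_add, inner_add_left, hw₀v]
      rw [hsum]
      rcases hmenu w hw with h | h | h <;> rw [h] <;> linarith
  exact ⟨a, ha, b, hb, c, hc, hind, occ a ha ha', occ b hb hb', occ c hc hc'⟩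

/-! ### Anchoring of the next ball: stepping inside the twin plane (kernel-decided slot table) -/

/-- **Kernel-decided slot table for the in-plane step.**  For every letter `i`, sign index `σ` and slot index `s₀` with `nrm i ⬝ slotInt s₀ = 0`
(the slot lies in the letter's plane), explicit indices `ka, kb, kc, k₁, k₂` (read off five literal tables) with: `slotInt ka = −slotInt s₀`;
`slotInt k₁ = slotInt kb + slotInt s₀` in the plane; `slotInt k₂ = slotInt kc + slotInt s₀` on the prescribed side (`nrm i ⬝ slotInt k₂ = ∓2`);
and non-zero triple product of `ka, kb, kc`. -/
theorem inPlane_table : ∀ (i : Fin 4) (σ : Fin 2) (s₀ : Fin 12), nrm i ⬝ᵥ slotInt s₀ = 0 →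
    slotInt ((![![![3, 0, 0, 0, 7, 0, 0, 4, 0, 10, 9, 0], ![3, 0, 0, 0, 7, 0, 0, 4, 0, 10, 9, 0]], ![![0, 2, 1, 0, 0, 6, 5, 0, 0, 10, 9, 0], ![0, 2, 1, 0, 0, 6, 5, 0, 0, 10, 9, 0]], ![![0, 2, 1, 0, 7, 0, 0, 4, 11, 0, 0, 8], ![0, 2, 1, 0, 7, 0, 0, 4, 11, 0, 0, 8]], ![![3, 0, 0, 0, 0, 6, 5, 0, 11, 0, 0, 8], ![3, 0, 0, 0, 0, 6, 5, 0, 11, 0, 0, 8]]] : Fin 4 → Fin 2 → Fin 12 → Fin 12) i σ s₀) = -slotInt s₀ ∧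
    slotInt ((![![![9, 0, 0, 10, 10, 0, 0, 9, 0, 7, 4, 0], ![9, 0, 0, 10, 10, 0, 0, 9, 0, 7, 4, 0]], ![![0, 10, 9, 0, 0, 9, 10, 0, 0, 5, 6, 0], ![0, 10, 9, 0, 0, 9, 10, 0, 0, 5, 6, 0]], ![![0, 11, 8, 0, 8, 0, 0, 11, 4, 0, 0, 7], ![0, 11, 8, 0, 8, 0, 0, 11, 4, 0, 0, 7]], ![![8, 0, 0, 11, 0, 11, 8, 0, 6, 0, 0, 5], ![8, 0, 0, 11, 0, 11, 8, 0, 6, 0, 0, 5]]] : Fin 4 → Fin 2 → Fin 12 → Fin 12) i σ s₀) = slotInt ((![![![7, 0, 0, 4, 3, 0, 0, 0, 0, 3, 0, 0], ![7, 0, 0, 4, 3, 0, 0, 0, 0, 3, 0, 0]], ![![0, 6, 5, 0, 0, 2, 1, 0, 0, 1, 2, 0], ![0, 6, 5, 0, 0, 2, 1, 0, 0, 1, 2, 0]], ![![0, 7, 4, 0, 2, 0, 0, 1, 1, 0, 0, 2], ![0, 7, 4, 0, 2, 0, 0, 1, 1, 0, 0, 2]], ![![6, 0, 0, 5, 0,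 3, 0, 0, 3, 0, 0, 0], ![6, 0, 0, 5, 0, 3, 0, 0, 3, 0, 0, 0]]] : Fin 4 → Fin 2 → Fin 12 → Fin 12) i σ s₀) + slotInt s₀ ∧
    nrm i ⬝ᵥ slotInt ((![![![9, 0, 0, 10, 10, 0, 0, 9, 0, 7, 4, 0], ![9, 0, 0, 10, 10, 0, 0, 9, 0, 7, 4, 0]], ![![0, 10, 9, 0, 0, 9, 10, 0, 0, 5, 6, 0], ![0, 10, 9, 0, 0, 9, 10, 0, 0, 5, 6, 0]], ![![0, 11, 8, 0, 8, 0, 0, 11, 4, 0, 0, 7], ![0, 11, 8, 0, 8, 0, 0, 11, 4, 0, 0, 7]], ![![8, 0, 0, 11, 0, 11, 8, 0, 6, 0, 0, 5], ![8, 0, 0, 11, 0, 11, 8, 0, 6, 0, 0, 5]]] : Fin 4 → Fin 2 → Fin 12 → Fin 12) i σ s₀) = 0 ∧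
    slotInt ((![![![5, 0, 0, 11, 1, 0, 0, 11, 0, 5, 1, 0], ![8, 0, 0, 6, 8, 0, 0, 2, 0, 2, 6, 0]], ![![0, 11, 7, 0, 0, 11, 3, 0, 0, 7, 3, 0], ![0, 4, 8, 0, 0, 0, 8, 0, 0, 0, 4, 0]], ![![0, 5, 9, 0, 0, 0, 0, 9, 0, 0, 0, 5], ![0, 10, 6, 0, 10, 0, 0, 3, 6, 0, 0, 3]], ![![4, 0, 0, 10, 0, 1, 10, 0, 4, 0, 0, 1], ![9, 0, 0, 7, 0, 9, 2, 0, 2, 0, 0, 7]]] : Fin 4 → Fin 2 → Fin 12 → Fin 12) i σ s₀) = slotInt ((![![![11, 0, 0, 5, 11, 0, 0, 1, 0, 1, 5, 0], ![6, 0, 0, 8, 2, 0, 0, 8, 0, 6, 2, 0]], ![![0, 7, 11, 0, 0, 3, 11, 0, 0, 3, 7, 0], ![0, 8, 4, 0, 0, 8, 0, 0, 0, 4, 0, 0]], ![![0, 9, 5, 0, 9, 0, 0, 0, 5, 0, 0, 0], ![0, 6, 10, 0, 3, 0, 0, 10, 3, 0, 0, 6]], ![![10, 0, 0, 4, 0,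 10, 1, 0, 1, 0, 0, 4], ![7, 0, 0, 9, 0, 2, 9, 0, 7, 0, 0, 2]]] : Fin 4 → Fin 2 → Fin 12 → Fin 12) i σ s₀) + slotInt s₀ ∧
    nrm i ⬝ᵥ slotInt ((![![![5, 0, 0, 11, 1, 0, 0, 11, 0, 5, 1, 0], ![8, 0, 0, 6, 8, 0, 0, 2, 0, 2, 6, 0]], ![![0, 11, 7, 0, 0, 11, 3, 0, 0, 7, 3, 0], ![0, 4, 8, 0, 0, 0, 8, 0, 0, 0, 4, 0]], ![![0, 5, 9, 0, 0, 0, 0, 9, 0, 0, 0, 5], ![0, 10, 6, 0, 10, 0, 0, 3, 6, 0, 0, 3]], ![![4, 0, 0, 10, 0, 1, 10, 0, 4, 0, 0, 1], ![9, 0, 0, 7, 0, 9, 2, 0, 2, 0, 0, 7]]] : Fin 4 → Fin 2 → Fin 12 → Fin 12) i σ s₀) = (if σ = 0 then -2 else 2) ∧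
    slotInt ((![![![3, 0, 0, 0, 7, 0, 0, 4, 0, 10, 9, 0], ![3, 0, 0, 0, 7, 0, 0, 4, 0, 10, 9, 0]], ![![0, 2, 1, 0, 0, 6, 5, 0, 0, 10, 9, 0], ![0, 2, 1, 0, 0, 6, 5, 0, 0, 10, 9, 0]], ![![0, 2, 1, 0, 7, 0, 0, 4, 11, 0, 0, 8], ![0, 2, 1, 0, 7, 0, 0, 4, 11, 0, 0, 8]], ![![3, 0, 0, 0, 0, 6, 5, 0, 11, 0, 0, 8], ![3, 0, 0, 0, 0, 6, 5, 0, 11, 0, 0, 8]]] : Fin 4 → Fin 2 → Fin 12 → Fin 12) i σ s₀) ⬝ᵥ crossInt (slotInt ((![![![7, 0, 0, 4, 3, 0, 0, 0, 0, 3, 0, 0], ![7, 0, 0, 4, 3, 0, 0, 0, 0, 3, 0, 0]], ![![0, 6, 5, 0, 0, 2, 1, 0, 0, 1, 2, 0], ![0, 6, 5, 0, 0, 2, 1, 0, 0, 1, 2, 0]], ![![0, 7, 4, 0, 2, 0, 0, 1, 1, 0, 0, 2], ![0, 7, 4, 0, 2, 0, 0, 1, 1, 0, 0, 2]], ![![6,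 0, 0, 5, 0, 3, 0, 0, 3, 0, 0, 0], ![6, 0, 0, 5, 0, 3, 0, 0, 3, 0, 0, 0]]] : Fin 4 → Fin 2 → Fin 12 → Fin 12) i σ s₀)) (slotInt ((![![![11, 0, 0, 5, 11, 0, 0, 1, 0, 1, 5, 0], ![6, 0, 0, 8, 2, 0, 0, 8, 0, 6, 2, 0]], ![![0, 7, 11, 0, 0, 3, 11, 0, 0, 3, 7, 0], ![0, 8, 4, 0, 0, 8, 0, 0, 0, 4, 0, 0]], ![![0, 9, 5, 0, 9, 0, 0, 0, 5, 0, 0, 0], ![0, 6, 10, 0, 3, 0, 0, 10, 3, 0, 0, 6]], ![![10, 0, 0, 4, 0, 10, 1, 0, 1, 0, 0, 4], ![7, 0, 0, 9, 0, 2, 9, 0, 7, 0, 0, 2]]] : Fin 4 → Fin 2 → Fin 12 → Fin 12) i σ s₀)) ≠ 0 := by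
  decide


/-- `inPlane_table`, existential form, negative side (`A⁻¹ n = +nrmVec i`). -/
theorem exists_inPlane_indices_neg (i : Fin 4) (s₀ : Fin 12) (h : nrm i ⬝ᵥ slotInt s₀ = 0) :
    ∃ ka kb kc k₁ k₂ : Fin 12, slotInt ka = -slotInt s₀ ∧ slotInt k₁ = slotInt kb + slotInt s₀ ∧ nrm i ⬝ᵥ slotInt k₁ = 0 ∧
      slotInt k₂ = slotInt kc + slotInt s₀ ∧ nrm i ⬝ᵥ slotInt k₂ = -2 ∧
      slotInt ka ⬝ᵥ crossInt (slotInt kb) (slotInt kc) ≠ 0 := by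
  obtain ⟨hka, hk₁, hk₁n, hk₂, hk₂n, hdet⟩ := inPlane_table i 0 s₀ h
  exact ⟨_, _, _, _, _, hka, hk₁, hk₁n, hk₂, by simpa using hk₂n, hdet⟩

/-- `inPlane_table`, existential form, positive side (`A⁻¹ n = −nrmVec i`). -/
theorem exists_inPlane_indices_pos (i : Fin 4) (s₀ : Fin 12) (h : nrm i ⬝ᵥ slotInt s₀ = 0) :
    ∃ ka kb kc k₁ k₂ : Fin 12, slotInt ka = -slotInt s₀ ∧ slotInt k₁ = slotInt kb + slotInt s₀ ∧ nrm i ⬝ᵥ slotInt k₁ = 0 ∧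
      slotInt k₂ = slotInt kc + slotInt s₀ ∧ nrm i ⬝ᵥ slotInt k₂ = 2 ∧
      slotInt ka ⬝ᵥ crossInt (slotInt kb) (slotInt kc) ≠ 0 := by
  obtain ⟨hka, hk₁, hk₁n, hk₂, hk₂n, hdet⟩ := inPlane_table i 1 s₀ h
  exact ⟨_, _, _, _, _, hka, hk₁, hk₁n, hk₂, by simpa using hk₂n, hdet⟩

/-- Integer additivity of slot indices transports to the slot vectors. -/
theorem slotSite_eq_add {s b c : Fin 12} (h : slotInt s = slotInt b + slotInt c) : slotSite s = slotSite b + slotSite c := by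
  apply cubicCoords_injective
  rw [cubicCoords_add, cubicCoords_slotSite, cubicCoords_slotSite, cubicCoords_slotSite]
  ext j
  simp only [slotVec, h, Pi.add_apply, Int.cast_add, add_div]

/-- In a frame `A` with `A⁻¹ n = nrmVec i`, the menu value of the slot `k` is `(nrm i ⬝ slotInt k)/(√2·√3)`. -/
theorem inner_frame_slotSite_of_eq (A : EuclideanSpace ℝ (Fin 3) ≃ₗᵢ[ℝ] EuclideanSpace ℝ (Fin 3)) {n : EuclideanSpace ℝ (Fin 3)} {i : Fin 4}
    (h : A.symm n = nrmVec i) (k : Fin 12) :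
    ⟪A (slotSite k), n⟫_ℝ = ((nrm i ⬝ᵥ slotInt k : ℤ) : ℝ) / (Real.sqrt 2 * Real.sqrt 3) := by
  have e : ⟪A (slotSite k), n⟫_ℝ = ⟪slotSite k, A.symm n⟫_ℝ := by
    rw [← A.inner_map_map (slotSite k) (A.symm n), LinearIsometryEquiv.apply_symm_apply]
  rw [e, h, inner_slotSite_nrmVec, dotProduct_comm]

/-- In a frame `A` with `A⁻¹ n = −nrmVec i`, the menu value of the slot `k` is `−(nrm i ⬝ slotInt k)/(√2·√3)`. -/
theorem inner_frame_slotSite_of_eq_neg (A : EuclideanSpace ℝ (Fin 3) ≃ₗᵢ[ℝ] EuclideanSpace ℝ (Fin 3)) {n : EuclideanSpace ℝ (Fin 3)} {i : Fin 4}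
    (h : A.symm n = -nrmVec i) (k : Fin 12) :
    ⟪A (slotSite k), n⟫_ℝ = -(((nrm i ⬝ᵥ slotInt k : ℤ) : ℝ) / (Real.sqrt 2 * Real.sqrt 3)) := by
  have e : ⟪A (slotSite k), n⟫_ℝ = ⟪slotSite k, A.symm n⟫_ℝ := by
    rw [← A.inner_map_map (slotSite k) (A.symm n), LinearIsometryEquiv.apply_symm_apply]
  rw [e, h, inner_neg_right, inner_slotSite_nrmVec, dotProduct_comm]

/-- **The in-plane slot triple.**  For a unit menu normal `n` of `A` and a slot `w₀` IN the plane (`⟪A w₀, n⟫ = 0`): slots `b`, `c` with `w₀ + b` a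
slot in the plane, `w₀ + c` a slot on the negative side, and `−w₀, b, c` linearly independent. -/
theorem exists_inPlane_triple (A : EuclideanSpace ℝ (Fin 3) ≃ₗᵢ[ℝ] EuclideanSpace ℝ (Fin 3)) {n : EuclideanSpace ℝ (Fin 3)} (hn : ‖n‖ = 1)
    (hmenu : ∀ w ∈ fccSlots, ⟪A w, n⟫_ℝ = 0 ∨ ⟪A w, n⟫_ℝ = Real.sqrt (2 / 3) ∨ ⟪A w, n⟫_ℝ = -Real.sqrt (2 / 3))
    {w₀ : EuclideanSpace ℝ (Fin 3)} (hw₀ : w₀ ∈ fccSlots) (hw₀n : ⟪A w₀, n⟫_ℝ = 0) :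
    ∃ b ∈ fccSlots, ∃ c ∈ fccSlots, LinearIndependent ℝ ![-w₀, b, c] ∧
      (w₀ + b ∈ fccSlots ∧ ⟪A (w₀ + b), n⟫_ℝ = 0) ∧ (w₀ + c ∈ fccSlots ∧ ⟪A (w₀ + c), n⟫_ℝ < 0) := by
  -- the normal is a letter, the slot an index
  have hμ1 : ‖A.symm n‖ = 1 := by rw [LinearIsometryEquiv.norm_map, hn]
  have hμmenu : ∀ w ∈ fccSlots, ⟪w, A.symm n⟫_ℝ = 0 ∨ ⟪w, A.symm n⟫_ℝ = Real.sqrt (2 / 3) ∨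
      ⟪w, A.symm n⟫_ℝ = -Real.sqrt (2 / 3) := by
    intro w hw
    rw [← A.inner_map_map w (A.symm n), LinearIsometryEquiv.apply_symm_apply]
    exact hmenu w hw
  obtain ⟨i, hi⟩ := exists_nrmVec_of_menu hμ1 hμmenu
  obtain ⟨s₀, rfl⟩ := exists_slotSite_eq hw₀
  have hden : (0 : ℝ) < Real.sqrt 2 * Real.sqrt 3 := by positivity
  rcases hi with hi | hi
  · have hval := inner_frame_slotSite_of_eq A hi
    have h0 : nrm i ⬝ᵥ slotInt s₀ = 0 := by
      have h1 := hval s₀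
      rw [hw₀n, eq_div_iff hden.ne', zero_mul] at h1
      exact_mod_cast h1.symm
    obtain ⟨ka, kb, kc, k₁, k₂, hka, hk₁, hk₁n, hk₂, hk₂n, hdet⟩ := exists_inPlane_indices_neg i s₀ h0
    refine ⟨slotSite kb, slotSite_mem kb, slotSite kc, slotSite_mem kc, ?_, ⟨?_, ?_⟩, ⟨?_, ?_⟩⟩
    · rw [← slotSite_eq_neg hka]; exact linearIndependent_slotSite hdet
    · rw [add_comm, ← slotSite_eq_add hk₁]; exact slotSite_mem k₁
    · rw [add_comm, ← slotSite_eq_add hk₁, hval k₁, hk₁n]; simp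
    · rw [add_comm, ← slotSite_eq_add hk₂]; exact slotSite_mem k₂
    · rw [add_comm, ← slotSite_eq_add hk₂, hval k₂, hk₂n]
      push_cast
      exact div_neg_of_neg_of_pos (by norm_num) hden
  · have hval := inner_frame_slotSite_of_eq_neg A hi
    have h0 : nrm i ⬝ᵥ slotInt s₀ = 0 := by
      have h1 := hval s₀
      rw [hw₀n, zero_eq_neg, div_eq_zero_iff] at h1
      rcases h1 with h1 | h1
      · exact_mod_cast h1
      · exact absurd h1 hden.ne'
    obtain ⟨ka, kb, kc, k₁, k₂, hka, hk₁, hk₁n, hk₂, hk₂n, hdet⟩ := exists_inPlane_indices_pos i s₀ h0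
    refine ⟨slotSite kb, slotSite_mem kb, slotSite kc, slotSite_mem kc, ?_, ⟨?_, ?_⟩, ⟨?_, ?_⟩⟩
    · rw [← slotSite_eq_neg hka]; exact linearIndependent_slotSite hdet
    · rw [add_comm, ← slotSite_eq_add hk₁]; exact slotSite_mem k₁
    · rw [add_comm, ← slotSite_eq_add hk₁, hval k₁, hk₁n]; simp
    · rw [add_comm, ← slotSite_eq_add hk₂]; exact slotSite_mem k₂
    · rw [add_comm, ← slotSite_eq_add hk₂, hval k₂, hk₂n]
      push_cast
      rw [neg_lt_zero]; exact div_pos (by norm_num) hden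

/-- **Stepping INSIDE the twin plane keeps both affine lattices**: in the twin-dozen alternative at `y ∈ (A· + t)''Λ₀` (unit menu normal `n`), the
in-plane contact `z = y + A w₀` (`⟪A w₀, n⟫ = 0`) lies in `(A· + t)''Λ₀` AND in its affine twin across the plane through `y` (it is on the plane),
and owns three linearly independent exact `A`-slot neighbours: `y`, one in-plane hexagon neighbour and one own polar neighbour of `y`. -/
theorem anchored_of_inPlane (A : EuclideanSpace ℝ (Fin 3) ≃ₗᵢ[ℝ] EuclideanSpace ℝ (Fin 3)) {t y n : EuclideanSpace ℝ (Fin 3)}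
    (hyL : y ∈ (fun r => A r + t) '' fccRef) (hy : y ∈ X) (hn : ‖n‖ = 1)
    (hmenu : ∀ w ∈ fccSlots, ⟪A w, n⟫_ℝ = 0 ∨ ⟪A w, n⟫_ℝ = Real.sqrt (2 / 3) ∨ ⟪A w, n⟫_ℝ = -Real.sqrt (2 / 3))
    (hown : ∀ w ∈ fccSlots, ⟪A w, n⟫_ℝ ≤ 0 → y + A w ∈ X)
    {w₀ : EuclideanSpace ℝ (Fin 3)} (hw₀ : w₀ ∈ fccSlots) (hw₀n : ⟪A w₀, n⟫_ℝ = 0) :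
    y + A w₀ ∈ (fun r => A r + t) '' fccRef ∧
      y + A w₀ ∈ (fun r => twinFrame A n r + (t + (2 * ⟪y - t, n⟫_ℝ) • n)) '' fccRef ∧
      ∃ a ∈ fccSlots, ∃ b ∈ fccSlots, ∃ c ∈ fccSlots, LinearIndependent ℝ ![a, b, c] ∧
        y + A w₀ + A a ∈ X ∧ y + A w₀ + A b ∈ X ∧ y + A w₀ + A c ∈ X := by
  have hmem : y + A w₀ ∈ (fun r => A r + t) '' fccRef := by
    rw [mem_affLat_iff_sub_mem hyL, add_sub_cancel_left]
    exact ⟨w₀, mem_fcc_of_mem_fccSlots hw₀, rfl⟩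
  refine ⟨hmem, ?_, ?_⟩
  · -- `z` lies on the plane through `y`, so the reflection fixes it
    have himg : (y + A w₀) - (2 * ⟪(y + A w₀) - y, n⟫_ℝ) • n ∈
        (fun x => x - (2 * ⟪x - y, n⟫_ℝ) • n) '' ((fun r => A r + t) '' fccRef) := ⟨_, hmem, rfl⟩
    rw [image_reflect_affLat A hn t y] at himg
    have e : (y + A w₀) - (2 * ⟪(y + A w₀) - y, n⟫_ℝ) • n = y + A w₀ := by
      rw [add_sub_cancel_left, hw₀n, mul_zero, zero_smul, sub_zero]
    rwa [e] at himg
  · obtain ⟨b, hb, c, hc, hind, ⟨hb', hb0⟩, ⟨hc', hcneg⟩⟩ := exists_inPlane_triple A hn hmenu hw₀ hw₀n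
    refine ⟨-w₀, neg_mem_fccSlots hw₀, b, hb, c, hc, hind, ?_, ?_, ?_⟩
    · rw [map_neg, add_neg_cancel_right]; exact hy
    · rw [add_assoc, ← map_add]; exact hown _ hb' hb0.le
    · rw [add_assoc, ← map_add]; exact hown _ hc' hcneg.le

end ColumnWord

end Summit.Ventures.Crystal3D.Theorems

end
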